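import Mathlib
import Summits.Ventures.HodgeRepro.Tier4.Target
import Summits.Ventures.HodgeRepro.Tier4.Line2.IsogenyPushforward

/-!
# Tier4/Line2/N2Diag — the N2 clause transfers along the diagonal pushforward (t4-plan-2 g2; v3-side S-item)

Blind re-derivation cell `pub-hodge-repro`, Tier 4 (README §9–§10), LINE L2.  The two STATEMENTS are the planner's
(t4-plan-2 g2, statements file efe74d4546aad668 · 77, S13413) VERBATIM; the proofs are by the prover t4-L2-p2 g3
(`comp_diag` + `ring` for one coordinate; the body is the four coordinates with the same `χₖ`).  Tree path
`lean/Summits/Ventures/HodgeRepro/Tier4/Line2/N2Diag.lean`; imports `Tier4.Target` + the landed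
`Tier4.Line2.IsogenyPushforward` (p676075) only — NOT the HOME-only `Tier4/TargetV3.lean`; every declaration
axioms ⊆ {propext, Classical.choice, Quot.sound}.

THE RUNG.  The `hN2` conjunct of the successor draft `P_T4v3` («TARGET-V3 DRAFT v3» 5cbd6eb48780e2c3 · 328, ruling-gated)
asks, for every central-modulo-`N` element `γ`, that the four `s`-coordinates `comp (T iₖ) s hsₖ (a' iₖ)` transform
AFFINELY under `γ` — `u(γ·z) = χₖ · u(z) + d` on the ball — with `χ₁ χ₂ = χ₃ χ₄`.  Under the diagonal pushforward
`a ↦ (σ ↦ c σ · a σ)` (cut (iv)) the `s`-coordinate is multiplied by the constant `c ⟨s, hs⟩` (`comp_diag`), so the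
affine law transfers with the SAME `χ` and `d ↦ c ⟨s, hs⟩ · d`.  Hence: the N2 body for a quadruple transfers to the N2
body for the pushed-forward quadruple, with the same `χₖ`, whence the same `χ₁ χ₂ = χ₃ χ₄`.  On L2-v3 this is the `hN2`
field of the line's family datum for the re-chosen quadruples `c_ν · a_ν` (v0.14v3-PREPARED S13348), once N2 holds for
the ν-corner's own lifts.  Consumed only under ruling (B2); stated WITHOUT `TargetData` / `P_T4v3` so that it is
proposable now.  Size S.  HC_CM is NOT proved by anyone in this repository.
-/

set_option autoImplicit false

noncomputable section

namespace Summit.Ventures.HodgeRepro.Tier4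

open Matrix

section N2Diag

variable {K : Type*} [Field K]

/-- **One coordinate**: an affine transformation law of the `s`-coordinate of `a` under a self-map `φ` of `ℂ²` transfers
to the `s`-coordinate of the pushed-forward lift `σ ↦ c σ · a σ`, with the same multiplier `χ`. -/
theorem affine_clause_diag (T : Finset (K →+* ℂ)) (s : K →+* ℂ) (hs : s ∈ T) (c : ↥T → ℂ)
    (a : (Fin 2 → ℂ) → (↥T → ℂ)) (φ : (Fin 2 → ℂ) → (Fin 2 → ℂ)) (χ : ℂ) :
    (∃ d : ℂ, ∀ z ∈ ball, comp T s hs a (φ z) = χ * comp T s hs a z + d) →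
    ∃ d : ℂ, ∀ z ∈ ball, comp T s hs (fun z σ => c σ * a z σ) (φ z) =
      χ * comp T s hs (fun z σ => c σ * a z σ) z + d := by
  rintro ⟨d, hd⟩
  refine ⟨c ⟨s, hs⟩ * d, fun z hz => ?_⟩
  simp only [comp_diag]
  rw [hd z hz]
  ring

/-- **The N2 body transfers** along the diagonal pushforward of the four lifts (`c i : ↥(T i) → ℂ` arbitrary, no
non-vanishing needed): same `χ₁ … χ₄`, hence the same relation `χ₁ χ₂ = χ₃ χ₄`.  The body is the `∃ χ₁ χ₂ χ₃ χ₄` clause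
of `P_T4v3`'s `hN2` (and of `TargetData.N2`), for one `γ`. -/
theorem n2_body_diag {E : Type*} [Field E] (τ₀ : E →+* ℂ) (C : Matrix (Fin 3) (Fin 3) ℂ)
    (γ : Matrix (Fin 3) (Fin 3) E) (T : Fin 4 → Finset (K →+* ℂ)) (s : K →+* ℂ) (i₁ i₂ i₃ i₄ : Fin 4)
    (hs₁ : s ∈ T i₁) (hs₂ : s ∈ T i₂) (hs₃ : conjEmb s ∈ T i₃) (hs₄ : conjEmb s ∈ T i₄)
    (c : ∀ i, ↥(T i) → ℂ) (a : ∀ i : Fin 4, (Fin 2 → ℂ) → (↥(T i) → ℂ)) :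
    (∃ χ₁ χ₂ χ₃ χ₄ : ℂ,
      (∃ d : ℂ, ∀ z ∈ ball, comp (T i₁) s hs₁ (a i₁) (actM (toBallMat τ₀ C γ) z) =
        χ₁ * comp (T i₁) s hs₁ (a i₁) z + d) ∧
      (∃ d : ℂ, ∀ z ∈ ball, comp (T i₂) s hs₂ (a i₂) (actM (toBallMat τ₀ C γ) z) =
        χ₂ * comp (T i₂) s hs₂ (a i₂) z + d) ∧
      (∃ d : ℂ, ∀ z ∈ ball, comp (T i₃) (conjEmb s) hs₃ (a i₃) (actM (toBallMat τ₀ C γ) z) =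
        χ₃ * comp (T i₃) (conjEmb s) hs₃ (a i₃) z + d) ∧
      (∃ d : ℂ, ∀ z ∈ ball, comp (T i₄) (conjEmb s) hs₄ (a i₄) (actM (toBallMat τ₀ C γ) z) =
        χ₄ * comp (T i₄) (conjEmb s) hs₄ (a i₄) z + d) ∧
      χ₁ * χ₂ = χ₃ * χ₄) →
    ∃ χ₁ χ₂ χ₃ χ₄ : ℂ,
      (∃ d : ℂ, ∀ z ∈ ball, comp (T i₁) s hs₁ (fun z σ => c i₁ σ * a i₁ z σ) (actM (toBallMat τ₀ C γ) z) =
        χ₁ * comp (T i₁) s hs₁ (fun z σ => c i₁ σ * a i₁ z σ) z + d) ∧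
      (∃ d : ℂ, ∀ z ∈ ball, comp (T i₂) s hs₂ (fun z σ => c i₂ σ * a i₂ z σ) (actM (toBallMat τ₀ C γ) z) =
        χ₂ * comp (T i₂) s hs₂ (fun z σ => c i₂ σ * a i₂ z σ) z + d) ∧
      (∃ d : ℂ, ∀ z ∈ ball, comp (T i₃) (conjEmb s) hs₃ (fun z σ => c i₃ σ * a i₃ z σ) (actM (toBallMat τ₀ C γ) z) =
        χ₃ * comp (T i₃) (conjEmb s) hs₃ (fun z σ => c i₃ σ * a i₃ z σ) z + d) ∧
      (∃ d : ℂ, ∀ z ∈ ball, comp (T i₄) (conjEmb s) hs₄ (fun z σ => c i₄ σ * a i₄ z σ) (actM (toBallMat τ₀ C γ) z) =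
        χ₄ * comp (T i₄) (conjEmb s) hs₄ (fun z σ => c i₄ σ * a i₄ z σ) z + d) ∧
      χ₁ * χ₂ = χ₃ * χ₄ := by
  rintro ⟨χ₁, χ₂, χ₃, χ₄, h₁, h₂, h₃, h₄, hχ⟩
  exact ⟨χ₁, χ₂, χ₃, χ₄, affine_clause_diag (T i₁) s hs₁ (c i₁) (a i₁) _ χ₁ h₁,
    affine_clause_diag (T i₂) s hs₂ (c i₂) (a i₂) _ χ₂ h₂,
    affine_clause_diag (T i₃) (conjEmb s) hs₃ (c i₃) (a i₃) _ χ₃ h₃,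
    affine_clause_diag (T i₄) (conjEmb s) hs₄ (c i₄) (a i₄) _ χ₄ h₄, hχ⟩

end N2Diag

end Summit.Ventures.HodgeRepro.Tier4

end
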